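import Literature.AlgebraicGeometry.HodgeTheory.AbelianVarietyHodgeFullnessOfUniformisation
import Literature.AlgebraicGeometry.HodgeTheory.ComplexTorusLatticeCoordinatesHodge
import Literature.AlgebraicGeometry.HodgeTheory.ClassesSupportedOnComplexification
import Literature.AlgebraicGeometry.HodgeTheory.HodgeStructureOfHodgeModel
import HarnessLib

/-!
# `H^{1,0}` of an algebraic complex torus is the dual `Hom_ℂ(V, ℂ)`, naturally in holomorphic maps

Family `hodge`, layer `Literature/AlgebraicGeometry/HodgeTheory`.  Sub-object (T2-d) of the proof of
the named fact `HodgeTheory.cotangent_hodge10_comparison` (`AbelianVarietyCotangentHodge`; TEAM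
hCMisogE TRACK 2): the «torus / `H¹` side».

[LangeBirkenhake1992] §1.1.5 Thm. 1.1.21 (b) (held chunk p0024): «there is a natural isomorphism
`H^q(Ω^p_X) ≃ ⋀^p Ω ⊗ ⋀^q Ω̄` with `Ω := Hom_ℂ(V, ℂ)`», for `(p,q) = (1,0)`: `H^{1,0}(X) ≅ Ω = Hom_ℂ(V, ℂ)`,
read in `H¹(X, ℂ) = Hom_ℝ(V, ℂ) = Hom(Λ, ℤ) ⊗ ℂ` (§1.1.3 Lemma 1.1.17 (a), Cor. 1.1.19); and §1.1.2
Prop. 1.1.6 / eq. (1.2) `A Π = Π' R` with Prop. 1.1.9 `ρᵣ ⊗ 1 ≃ ρₐ ⊕ ρ̄ₐ`: on `Hom_ℂ(V, ℂ)` the pull-back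
`f^*` along a homomorphism `f` with analytic representation `ρₐ(f) = L` is `ℓ ↦ ℓ ∘ L`.

TYPED on the tree's carriers and PROVED (0 named facts): for a smooth projective `X/ℂ` of dimension `n`
which is the analytification `φ : E/Φ(ℤ^ι) → X(ℂ)` of a complex torus of the tree
(`Geometry.Kaehler.ComplexTorus Φ`, `Transcendental.IsAnalytification`) and the ℂ-submodule
`W ⊆ H¹(X(ℂ); ℂ)` of classes of Hodge type `(1,0)` (membership currency
`v ∈ W ↔ IsOfHodgeType n X 1 1 0 v`, as in `cotangent_hodge10_comparison`):

* `HodgeTheory.exists_dual_equiv_hodgeOneZero_natural` — there is a ℂ-linear isomorphism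
  `Ξ : (E →L[ℂ] ℂ) ≃ W` such that for every `ℂ`-morphism `g : X ⟶ X` which, read on the torus, is the
  homomorphism `mapMatrix Φ Φ A` of an integer matrix `A` with `ℂ`-linear analytic representation `L`
  (`Φ ∘ A_ℝ = L ∘ Φ`), one has `Ξ (ℓ ∘ L) = g^* (Ξ ℓ)`;
* `HodgeTheory.exists_hodgeOneZeroDual` — the same at a complex abelian variety `B` (`X := B.X`,
  `E := ℂ^{dim B}`, endomorphisms `g : B ⟶ B`), the interface of record of TRACK 2 (`NAMES-T2.md` §2).

The isomorphism is `ℓ ↦ β ((c⁻¹ ⊗ ℂ) (row ℓ))`: `row ℓ = Σₐ ℓ(Φ eₐ) ⊗ eₐ` the period row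
(`dualPeriodRow`, `ComplexTorusHodgeMorphismLift`), `c = latticeCoordHOne Φ ∘ φ^*` the canonical lattice
coordinates on `H¹(X(ℂ); ℚ)` (`AbelianVarietyHodgeFullnessOfUniformisation`), `β : ℂ ⊗ H¹(X(ℂ); ℚ) ≃ H¹(X(ℂ); ℂ)`
(`ofRatClassBaseChangeEquiv`).  Its image is `W` by the tree's THEOREM
`complexTorus_latticeCoordHOne_hodgeOneZero_holds` ((1,0)-classes ↔ period rows of ℂ-linear functionals,
`ComplexTorusLatticeCoordinatesHodge`); naturality is `ofRatClassBaseChange_baseChange_map` (β is natural),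
`latticeCoordHOne_map_mapMatrix` (`mapMatrix A` acts on lattice coordinates by `Aᵀ`) and
`baseChange_periodRow` (`Aᵀ ⊗ ℂ` on period rows is pre-composition with the analytic representation).

The consumer (T2-e, `cotangent_hodge10_comparison_holds`) composes `Ξ` with the differential at the
origin `Ψ₀ : 𝔪_e/𝔪_e² ≃ (E →L[ℂ] ℂ)` (T2-a/b/c), using for each endomorphism `g` of an abelian variety the
pair `(A, L)` of [LangeBirkenhake1992] Prop. 1.1.6 — in the tree EXACTLY in the shape of the two
hypotheses below: `ComplexMultiplication.exists_rationalRep_analyticRep`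
(`RationalInvariantFormsOfUniformisation`; GAGA for maps + `ComplexTorus.exists_eq_mapMatrix_of_map_zero`).

## References

* [LangeBirkenhake1992] H. Lange, Ch. Birkenhake, *Complex Abelian Varieties* (1992), §1.1.2 Prop. 1.1.6,
  eq. (1.2), Prop. 1.1.9; §1.1.3 Lemma 1.1.17 (a), Cor. 1.1.19; §1.1.5 Thm. 1.1.21 (b) (held chunks
  p0019–p0020, p0023–p0025).
* [SerreGAGA1956] J.-P. Serre, *Géométrie algébrique et géométrie analytique* (1956), §2 (reading an
  algebraic variety through its analytification).
-/

noncomputable section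

open CategoryTheory
open scoped TensorProduct Manifold ContDiff
open Literature.AlgebraicTopology.SingularHomology (singularCohomology)
open Literature.NumberTheory.Transcendental (IsAnalytification)
open Literature.Geometry.Kaehler (ComplexTorus)
open Literature.AlgebraicGeometry.Motives (bettiCohomology ComplexPoints AlgPoints IsSmoothProjective
  ofRatClassBaseChange SchemeOver)

namespace Literature.AlgebraicGeometry.HodgeTheory

variable {ι : Type} [Fintype ι] [DecidableEq ι] {E : Type} [NormedAddCommGroup E] [NormedSpace ℂ E]
  [FiniteDimensional ℂ E]

/-- **`H^{1,0}(X) ≅ Hom_ℂ(V, ℂ)`, naturally** ([LangeBirkenhake1992] §1.1.5 Thm. 1.1.21 (b) for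
`(p,q) = (1,0)`: «`H^q(Ω^p_X) ≃ ⋀^p Ω ⊗ ⋀^q Ω̄` with `Ω := Hom_ℂ(V, ℂ)`», inside
`H¹(X, ℂ) = Hom_ℝ(V, ℂ)` (Cor. 1.1.19); §1.1.2 Prop. 1.1.6, eq. (1.2) and Prop. 1.1.9: a homomorphism
with rational representation `A` and analytic representation `L` acts on `H¹ = Hom(Λ, –)` by `Aᵀ` and on
`Hom_ℂ(V, ℂ)` by `ℓ ↦ ℓ ∘ L`).  For a smooth projective `X/ℂ` analytified by the torus `E/Φ(ℤ^ι)` via `φ`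
and the submodule `W` of `(1,0)`-classes of `H¹(X(ℂ); ℂ)`: a ℂ-linear isomorphism `Ξ` from the
continuous dual `E →L[ℂ] ℂ` onto `W` with `Ξ (ℓ ∘ L) = g^* (Ξ ℓ)` whenever `g(ℂ) ∘ φ = φ ∘ mapMatrix A`
and `Φ ∘ A_ℝ = L ∘ Φ`.
[cite: LangeBirkenhake1992, §1.1.5 Thm. 1.1.21 (b); §1.1.3 Cor. 1.1.19; §1.1.2 Prop. 1.1.6, eq. (1.2), Prop. 1.1.9] -/
theorem exists_dual_equiv_hodgeOneZero_natural (Φ : (ι → ℝ) ≃L[ℝ] E) {n : ℕ} {X : SchemeOver ℂ}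
    (hX : IsSmoothProjective n X) (φ : ComplexTorus Φ → ComplexPoints X)
    (hφ : IsAnalytification E X n φ) (W : Submodule ℂ (complexBetti X 1))
    (hW : ∀ v, v ∈ W ↔ IsOfHodgeType n X 1 1 0 v) :
    ∃ Ξ : (E →L[ℂ] ℂ) ≃ₗ[ℂ] W,
      ∀ (g : X ⟶ X) (A : Matrix ι ι ℤ) (L : E →L[ℂ] E),
        (∀ t, φ (ComplexTorus.mapMatrix Φ Φ A t) = AlgPoints.map g (φ t)) →
        (∀ x : ι → ℝ, Φ ((A.map (Int.cast : ℤ → ℝ)).mulVec x) = L (Φ x)) →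
        ∀ ℓ : E →L[ℂ] ℂ, (Ξ (ℓ.comp L) : complexBetti X 1) = (complexBetti.map g 1).hom (Ξ ℓ) := by
  classical
  -- `φ` as a continuous map and the induced isomorphism `φ^* : H¹(X(ℂ); ℚ) ≃ H¹(T; ℚ)`
  let φc : C(ComplexTorus Φ, ComplexPoints X) := ⟨φ, hφ.isHomeomorph.continuous⟩
  let eφ : singularCohomology ℚ ℚ (ComplexPoints X) 1 ≃ₗ[ℚ] singularCohomology ℚ ℚ (ComplexTorus Φ) 1 :=
    (singularCohomology.mapIso ℚ ℚ (hφ.isHomeomorph.homeomorph φ) 1).toLinearEquiv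
  have hcoe : ((hφ.isHomeomorph.homeomorph φ : ComplexTorus Φ ≃ₜ ComplexPoints X) :
      C(ComplexTorus Φ, ComplexPoints X)) = φc := ContinuousMap.ext fun _ => rfl
  have heφ : ∀ y, eφ y = (singularCohomology.map ℚ ℚ φc 1).hom y := by
    intro y
    change (singularCohomology.mapIso ℚ ℚ (hφ.isHomeomorph.homeomorph φ) 1).hom y = _
    rw [singularCohomology.mapIso_hom, hcoe]
  -- canonical lattice coordinates `c = coord_Φ ∘ φ^*` on `H¹(X(ℂ); ℚ)`
  let c : singularCohomology ℚ ℚ (ComplexPoints X) 1 ≃ₗ[ℚ] (ι → ℚ) := eφ.trans (latticeCoordHOne Φ)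
  have hc : c.toLinearMap =
      (latticeCoordHOne Φ).toLinearMap ∘ₗ (singularCohomology.map ℚ ℚ φc 1).hom := by
    refine LinearMap.ext fun y => ?_
    change latticeCoordHOne Φ (eφ y) = latticeCoordHOne Φ ((singularCohomology.map ℚ ℚ φc 1).hom y)
    rw [heφ]
  -- the complexification `β : ℂ ⊗ H¹(X(ℂ); ℚ) ≃ H¹(X(ℂ); ℂ)`
  let β : ℂ ⊗[ℚ] bettiCohomology X 1 ≃ₗ[ℂ] complexBetti X 1 := ofRatClassBaseChangeEquiv hX 1
  -- the map `T : ℓ ↦ β ((c⁻¹ ⊗ ℂ) (row ℓ))`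
  let T : (E →L[ℂ] ℂ) →ₗ[ℂ] complexBetti X 1 :=
    β.toLinearMap ∘ₗ c.symm.toLinearMap.baseChange ℂ ∘ₗ dualPeriodRow Φ
  have hT : ∀ ℓ, T ℓ = β (c.symm.toLinearMap.baseChange ℂ (dualPeriodRow Φ ℓ)) := fun ℓ => rfl
  -- `(c ⊗ ℂ) ∘ (c⁻¹ ⊗ ℂ) = id` and `(c⁻¹ ⊗ ℂ) ∘ (c ⊗ ℂ) = id`
  have hcc : ∀ z, c.toLinearMap.baseChange ℂ (c.symm.toLinearMap.baseChange ℂ z) = z := by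
    intro z
    rw [← LinearMap.comp_apply, ← LinearMap.baseChange_comp]
    have : c.toLinearMap ∘ₗ c.symm.toLinearMap = LinearMap.id :=
      LinearMap.ext fun y => c.apply_symm_apply y
    rw [this, LinearMap.baseChange_id, LinearMap.id_apply]
  have hcc' : ∀ z, c.symm.toLinearMap.baseChange ℂ (c.toLinearMap.baseChange ℂ z) = z := by
    intro z
    rw [← LinearMap.comp_apply, ← LinearMap.baseChange_comp]
    have : c.symm.toLinearMap ∘ₗ c.toLinearMap = LinearMap.id :=
      LinearMap.ext fun y => c.symm_apply_apply y
    rw [this, LinearMap.baseChange_id, LinearMap.id_apply]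
  -- (C): a class is of type `(1,0)` iff its coordinates are a `(1,0)`-row
  have hC : ∀ x : ℂ ⊗[ℚ] singularCohomology ℚ ℚ (ComplexPoints X) 1,
      IsOfHodgeType n X 1 1 0 (ofRatClassBaseChange (ComplexPoints X) 1 x) ↔
        c.toLinearMap.baseChange ℂ x ∈ hodgeOneZeroRows Φ := by
    intro x
    rw [complexTorus_latticeCoordHOne_hodgeOneZero_holds Φ hX φc hφ x, ← hc]
  -- `T` is injective
  have hTinj : Function.Injective T := by
    intro ℓ ℓ' h
    rw [hT, hT] at h
    have h1 := β.injective h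
    have h2 : dualPeriodRow Φ ℓ = dualPeriodRow Φ ℓ' := by
      rw [← hcc (dualPeriodRow Φ ℓ), ← hcc (dualPeriodRow Φ ℓ'), h1]
    exact dualPeriodRow_injective Φ h2
  -- the range of `T` is `W`
  have hTrange : LinearMap.range T = W := by
    apply le_antisymm
    · rintro _ ⟨ℓ, rfl⟩
      rw [hW, hT]
      change IsOfHodgeType n X 1 1 0 (ofRatClassBaseChange (ComplexPoints X) 1 _)
      rw [hC, hcc]
      exact ⟨ℓ, rfl⟩
    · intro w hw
      obtain ⟨x, rfl⟩ := β.surjective w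
      have hx : IsOfHodgeType n X 1 1 0 (ofRatClassBaseChange (ComplexPoints X) 1 x) := (hW _).1 hw
      rw [hC] at hx
      obtain ⟨ℓ, hℓ⟩ := (LinearMap.mem_range).1 hx
      refine ⟨ℓ, ?_⟩
      rw [hT]
      change β (c.symm.toLinearMap.baseChange ℂ (dualPeriodRow Φ ℓ)) = β x
      rw [hℓ, hcc']
  -- the isomorphism
  let Ξ : (E →L[ℂ] ℂ) ≃ₗ[ℂ] W :=
    (LinearEquiv.ofInjective T hTinj).trans (LinearEquiv.ofEq _ _ hTrange)
  have hΞ : ∀ ℓ, (Ξ ℓ : complexBetti X 1) = T ℓ := fun ℓ => rfl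
  refine ⟨Ξ, fun g A L hg hA ℓ => ?_⟩
  rw [hΞ, hΞ, hT, hT]
  change ofRatClassBaseChange (ComplexPoints X) 1 _ =
    (complexBetti.map g 1).hom (ofRatClassBaseChange (ComplexPoints X) 1 _)
  -- naturality of `β`: `g^* (β y) = β ((g(ℂ)^* ⊗ ℂ) y)`
  refine Eq.trans ?_ (HodgeModel.ofRatClassBaseChange_baseChange_map g 1
    (c.symm.toLinearMap.baseChange ℂ (dualPeriodRow Φ ℓ)))
  congr 1
  -- `mapMatrix A` is continuous (it is holomorphic, its lift being `L`)
  have hcont : Continuous (ComplexTorus.mapMatrix Φ Φ A) :=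
    (ComplexTorus.contMDiff_mapMatrix (𝕜 := ℂ) (n := 0) L hA).continuous
  let hM : C(ComplexTorus Φ, ComplexTorus Φ) := ⟨ComplexTorus.mapMatrix Φ Φ A, hcont⟩
  -- functoriality along `g(ℂ) ∘ φ = φ ∘ mapMatrix A`
  have hcomm : φc.comp hM = (AlgPoints.mapContinuous (L := ℂ) g).comp φc :=
    ContinuousMap.ext fun t => hg t
  have hfun : ∀ z, (singularCohomology.map ℚ ℚ φc 1).hom
        ((singularCohomology.map ℚ ℚ (AlgPoints.mapContinuous (L := ℂ) g) 1).hom z) =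
      (singularCohomology.map ℚ ℚ hM 1).hom ((singularCohomology.map ℚ ℚ φc 1).hom z) := by
    intro z
    change (singularCohomology.map ℚ ℚ (AlgPoints.mapContinuous (L := ℂ) g) 1 ≫
        singularCohomology.map ℚ ℚ φc 1).hom z =
      (singularCohomology.map ℚ ℚ φc 1 ≫ singularCohomology.map ℚ ℚ hM 1).hom z
    rw [← singularCohomology.map_comp, ← singularCohomology.map_comp, hcomm]
  -- in lattice coordinates `g(ℂ)^*` is `Aᵀ` (naturality (C₀), `latticeCoordHOne_map_mapMatrix`)
  let ψ : (ι → ℚ) →ₗ[ℚ] (ι → ℚ) := Matrix.toLin' (A.transpose.map (Int.cast : ℤ → ℚ))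
  have hψc : ∀ y, c ((singularCohomology.map ℚ ℚ (AlgPoints.mapContinuous (L := ℂ) g) 1).hom
      (c.symm y)) = ψ y := by
    intro y
    have h1 : (singularCohomology.map ℚ ℚ φc 1).hom (c.symm y) = (latticeCoordHOne Φ).symm y := by
      have : c.symm y = eφ.symm ((latticeCoordHOne Φ).symm y) := rfl
      rw [this, ← heφ, LinearEquiv.apply_symm_apply]
    change latticeCoordHOne Φ (eφ _) = _
    rw [heφ, hfun, h1, latticeCoordHOne_map_mapMatrix Φ Φ A hM (fun _ => rfl) y, Matrix.toLin'_apply]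
  have key : ∀ z, c.toLinearMap.baseChange ℂ
      ((singularCohomology.map ℚ ℚ (AlgPoints.mapContinuous (L := ℂ) g) 1).hom.baseChange ℂ
        (c.symm.toLinearMap.baseChange ℂ z)) = ψ.baseChange ℂ z := by
    intro z
    induction z using TensorProduct.induction_on with
    | zero => simp only [map_zero]
    | tmul a y => simp only [LinearMap.baseChange_tmul, LinearEquiv.coe_coe, hψc]
    | add z z' hz hz' => simp only [map_add, hz, hz']
  -- apply `(c ⊗ ℂ)`: the claim is `row (ℓ ∘ L) = (Aᵀ ⊗ ℂ) (row ℓ)`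
  rw [← hcc' ((singularCohomology.map ℚ ℚ (AlgPoints.mapContinuous (L := ℂ) g) 1).hom.baseChange ℂ
    (c.symm.toLinearMap.baseChange ℂ (dualPeriodRow Φ ℓ))), key]
  congr 1
  -- `(Aᵀ ⊗ ℂ) (row ℓ) = row (ℓ ∘ ρₐ(A))` and `ρₐ(A) = realRep A = L`
  rw [dualPeriodRow_apply, dualPeriodRow_apply, baseChange_periodRow Φ Φ ψ]
  have hmat : (LinearMap.toMatrix' ψ).transpose = A.map (Int.cast : ℤ → ℚ) := by
    rw [LinearMap.toMatrix'_toLin', Matrix.transpose_map, Matrix.transpose_transpose]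
  rw [hmat, ratAnalyticRep_intCast]
  congr 1
  refine LinearMap.ext fun v => ?_
  obtain ⟨x, rfl⟩ := Φ.surjective v
  simp only [LinearMap.coe_restrictScalars, LinearMap.comp_apply, ContinuousLinearMap.coe_coe,
    ContinuousLinearMap.comp_apply, ComplexTorus.realRep_apply, hA]

/-- **(T2-d) at an abelian variety, in the interface of record** (TEAM hCMisogE TRACK 2, `NAMES-T2.md`
§2): for a complex abelian variety `B` analytified by the torus `ℂ^{dim B}/Φ(ℤ^ι)` via `φ` and the
submodule `W` of `(1,0)`-classes of `H¹(B(ℂ); ℂ)`, a ℂ-linear isomorphism `Ξ : Hom_ℂ(ℂ^{dim B}, ℂ) ≃ W`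
with `Ξ (ℓ ∘ L) = g^* (Ξ ℓ)` for every endomorphism `g` of `B` with rational representation `A` and
analytic representation `L` on the torus ([LangeBirkenhake1992] §1.1.5 Thm. 1.1.21 (b), §1.1.2
Prop. 1.1.6 / eq. (1.2) / Prop. 1.1.9; the pair `(A, L)` is
`ComplexMultiplication.exists_rationalRep_analyticRep`).  Corollary of
`exists_dual_equiv_hodgeOneZero_natural` at `X := B.X`, `hX := isSmoothProjective_holds`.
[cite: LangeBirkenhake1992, §1.1.5 Thm. 1.1.21 (b); §1.1.2 Prop. 1.1.6, eq. (1.2), Prop. 1.1.9] -/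
theorem exists_hodgeOneZeroDual {B : Motives.AbelianVariety ℂ} {Φ : (ι → ℝ) ≃L[ℝ] (Fin B.dim → ℂ)}
    {φ : ComplexTorus Φ → ComplexPoints B.X} (hφ : IsAnalytification (Fin B.dim → ℂ) B.X B.dim φ)
    {W : Submodule ℂ (complexBetti B.X 1)} (hW : ∀ v, v ∈ W ↔ IsOfHodgeType B.dim B.X 1 1 0 v) :
    ∃ Ξ : ((Fin B.dim → ℂ) →L[ℂ] ℂ) ≃ₗ[ℂ] W,
      ∀ (g : B ⟶ B) (A : Matrix ι ι ℤ) (L : (Fin B.dim → ℂ) →L[ℂ] (Fin B.dim → ℂ)),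
        (∀ x : ι → ℝ, Φ ((A.map (Int.cast : ℤ → ℝ)).mulVec x) = L (Φ x)) →
        (∀ t, φ (ComplexTorus.mapMatrix Φ Φ A t) = AlgPoints.map g.hom.hom.hom (φ t)) →
        ∀ ℓ : (Fin B.dim → ℂ) →L[ℂ] ℂ,
          (Ξ (ℓ.comp L) : complexBetti B.X 1) = (complexBetti.map g.hom.hom.hom 1).hom (Ξ ℓ) := by
  obtain ⟨Ξ, hΞ⟩ := exists_dual_equiv_hodgeOneZero_natural Φ
    (Motives.AbelianVariety.isSmoothProjective_holds (A := B)) φ hφ W hW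
  exact ⟨Ξ, fun g A L hAL hcomm ℓ => hΞ g.hom.hom.hom A L hcomm hAL ℓ⟩

end Literature.AlgebraicGeometry.HodgeTheory

end
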